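import Summits.QuantumFields.YangMills.Theorems.BalabanUVNodesN07SectBRemainderAtObjects
import Literature.MathematicalPhysics.QuantumFieldTheory.Balaban1983to89.B11Eq31V4Bound
import HarnessLib

/-!
# BalabanUVNodes ∕ N07 — [Balaban1985Variational] Sect. B (29)–(31) AT THE OBJECTS OF RECORD: the trace functional of record `τ_N = N⁻¹·tr` has `|τ_N(Z·U(∂p))| ≤ ‖Z‖` at every
# `SU(N)` background, so print's fourth-order bound (31) «|V₄(A,∂p)| ≤ (1∕4!)(|A|(∂p))⁴ e^{η|A|(∂p)}» holds there with NO trace hypothesis, and the third-order remainder bound of (26)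
# (`…N07SectBRemainderAtObjects.norm_rem3_cfgGL_le`) loses its symbolic factor `‖τ‖` at `τ = τ_N` (S1 successor (e′) of seat `pub-ymgap-dag-n07-w1`; ref-L READ-148's two located notes)

Cell `pub-ymgap`, width seat `pub-ymgap-dag-n07-w1` generation 4 (DAG node N07 = [15] = [Balaban1985Variational]; S1 «[15] Sect. B at NODE 00's objects», item (e′)).
`--kind proof --supports stmt-QuantumFields-20542 --as helper` (K1⁷; count-neutral; theorems only).  CONSUMED BY NAME, nothing modified: r08's `B11Eq31V4Bound.ineq31 ∕ ineq31_mono` ((31) for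
four exponentials in a complete normed algebra, with the trace estimate `|tr(Z U₀(∂p))| ≤ |Z|` as HYPOTHESIS `hτ`), g0's `…N07SectBExpansionAtObjects.trN_apply` (`τ_N = ntr`) and
`…N07SectBRemainderAtObjects.plaqU_cfgGL_mem_unitary ∕ norm_rem3_cfgGL_le`, `MatrixNorms.norm_ntr_le_opNorm` ([4] (20): `|ntr X| ≤ ‖X‖`), Mathlib `CStarRing.norm_of_mem_unitary`,
`LinearMap.toContinuousLinearMap`, `ContinuousLinearMap.opNorm_le_bound`.

THE PRINT.  [Balaban1985Variational] p. 282: (29) `V₀(A) = V^{(3)}(A) + V₄(A)`, (30), (31) «|V₄(A, ∂p)| ≦ (1∕4!)(|A|(∂p))⁴ e^{η|A|(∂p)}» — for `A` in the COMPLEXIFIED Lie algebra; the silent estimate behind it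
is `|tr(Z U₀(∂p))| ≤ |Z|` for the normalised trace and the unitary `U₀(∂p)` ([Balaban1985Averaging] (17), (20) p. 20; [Balaban1985BackgroundPropagators] p. 392 «tr 1 = 1»).

CONTENTS (`M = M_N(ℂ)`, L2-operator norm; `τ_N = (N:ℂ)⁻¹ • Matrix.traceLinearMap`; `N ≥ 1`).
* §1 `norm_trN_le` (`‖τ_N X‖ ≤ ‖X‖`), `norm_trN_mul_le_of_norm_le_one`, ★ `norm_trN_mul_unitary_le` (`‖τ_N(Z·U)‖ ≤ ‖Z‖` for unitary `U`), `norm_trN_mul_coe_SU_le`, ★ `norm_trN_mul_plaqU_cfgGL_le` (at the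
  plaquette variable of record — `hτ` of (31) DISCHARGED), `opNorm_trN_le_one` (`‖τ_N‖ ≤ 1` as a continuous functional).
* §2 ★★ `ineq31_cfgGL` ∕ `ineq31_cfgGL_mono` — **(31) AT EVERY `SU(N)` BACKGROUND OF RECORD** (`τ := τ_N`, `U₀(∂p) := plaqU (torusT P j) (dirForm (cfgGL N U₀)) μ ν x`; the four letters `A′(bᵢ)` and their
  majorants free, as printed «for A belonging to the complexified Lie algebra»); `ineq31_coe_SU` (the same against any `SU(N)`-valued plaquette variable, e.g. `plaqHol U₀ p`).
* §3 ★ `norm_rem3_cfgGL_trN_le` — g0's third-order remainder bound at `τ = τ_N` with `‖τ‖ ≤ 1` discharged: `‖ρ_p‖ ≤ expTail 3 (|η|·Σ_{b⊂∂p}‖A′(b)‖)`.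

HONEST FRAMING: instantiation of kernel-checked generic statements at the record's letters + the elementary trace estimate; NO new analysis; (31) is a bound on the fourth-order TAIL of one plaquette
term, nothing about Sects. C–G; N07 NOT discharged; counts unmoved (typed 28∕28 · discharged 5∕27); one finite 𝕋⁴ programme at fixed ε — NOT continuum ∕ ℝ⁴ ∕ OS ∕ mass gap ∕ Clay (R4 closes the conditional
finite-𝕋⁴ rung `BalabanLadder.UV` only).  No `sorry`, no `def`, no `instance`, no `notation`.
-/

noncomputable section

namespace Summit.QuantumFields.YangMills.BalabanUVNodes.N07SectBV4BoundAtObjects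

open Literature.MathematicalPhysics.QuantumFieldTheory.Balaban1983to89
open Literature.MathematicalPhysics.QuantumFieldTheory.Balaban1983to89.Node00
open B9Eq39Adjoint (plaqU rem3 lettersA)
open B9TorusCalculus (torusT)
open B12Eq18Current (dirForm)
open Beta.TransportVertices (expTail size expTail_nonneg size_nonneg)
open MatrixNorms (ntr norm_ntr_le_opNorm)
open B11Eq31V4Bound (grade4 ineq31 ineq31_mono)
open Summit.QuantumFields.YangMills.BalabanUVNodes.N07SectBExpansionAtObjects (trN_apply)
open Summit.QuantumFields.YangMills.BalabanUVNodes.N07SectBRemainderAtObjects (plaqU_cfgGL_mem_unitary norm_rem3_cfgGL_le)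
open scoped Matrix.Norms.L2Operator Nat
open NormedSpace Finset

variable {N : ℕ}

/-! ## §1  The trace functional of record is dominated by the operator norm; `hτ` of (31) at unitaries -/

/-- `‖τ_N X‖ ≤ ‖X‖` ([4] (20) for the normalised trace, `MatrixNorms.norm_ntr_le_opNorm`, through g0's `trN_apply`). [cite: Balaban1985Averaging, (20) p.20] -/
theorem norm_trN_le (X : Matrix (Fin N) (Fin N) ℂ) : ‖((N : ℂ)⁻¹ • Matrix.traceLinearMap (Fin N) ℂ ℂ) X‖ ≤ ‖X‖ := by
  rw [trN_apply]
  exact norm_ntr_le_opNorm X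

/-- `‖τ_N(Z·U)‖ ≤ ‖Z‖` whenever `‖U‖ ≤ 1` (submultiplicativity). [cite: Balaban1985Averaging, (20) p.20 (bookkeeping)] -/
theorem norm_trN_mul_le_of_norm_le_one (Z : Matrix (Fin N) (Fin N) ℂ) {U0 : Matrix (Fin N) (Fin N) ℂ} (hU : ‖U0‖ ≤ 1) :
    ‖((N : ℂ)⁻¹ • Matrix.traceLinearMap (Fin N) ℂ ℂ) (Z * U0)‖ ≤ ‖Z‖ :=
  calc ‖((N : ℂ)⁻¹ • Matrix.traceLinearMap (Fin N) ℂ ℂ) (Z * U0)‖ ≤ ‖Z * U0‖ := norm_trN_le _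
    _ ≤ ‖Z‖ * ‖U0‖ := norm_mul_le _ _
    _ ≤ ‖Z‖ * 1 := mul_le_mul_of_nonneg_left hU (norm_nonneg _)
    _ = ‖Z‖ := mul_one _

variable [NeZero N]

/-- ★ **THE SILENT TRACE ESTIMATE OF (31)**: `‖τ_N(Z·U)‖ ≤ ‖Z‖` for every UNITARY `U` (`‖U‖ = 1`, `N ≥ 1`). [cite: Balaban1985Variational, (31) p.282; Balaban1985Averaging, (20) p.20] -/
theorem norm_trN_mul_unitary_le (Z : Matrix (Fin N) (Fin N) ℂ) {U0 : Matrix (Fin N) (Fin N) ℂ} (hU0 : U0 ∈ unitary (Matrix (Fin N) (Fin N) ℂ)) :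
    ‖((N : ℂ)⁻¹ • Matrix.traceLinearMap (Fin N) ℂ ℂ) (Z * U0)‖ ≤ ‖Z‖ :=
  norm_trN_mul_le_of_norm_le_one Z (le_of_eq (CStarRing.norm_of_mem_unitary hU0))

/-- The same against the matrix of any `g ∈ SU(N)` (e.g. a plaquette variable `plaqHol U₀ p` of an `SU(N)` configuration). [cite: Balaban1985Variational, (31) p.282; Balaban1985Averaging, (20) p.20] -/
theorem norm_trN_mul_coe_SU_le (Z : Matrix (Fin N) (Fin N) ℂ) (g : SU N) :
    ‖((N : ℂ)⁻¹ • Matrix.traceLinearMap (Fin N) ℂ ℂ) (Z * (g : Matrix (Fin N) (Fin N) ℂ))‖ ≤ ‖Z‖ :=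
  norm_trN_mul_unitary_le Z (Matrix.specialUnitaryGroup_le_unitaryGroup g.2)

variable {P : Params} {j : ℕ}

/-- ★ `hτ` OF (31) DISCHARGED AT THE PLAQUETTE VARIABLE OF RECORD: `‖τ_N(Z·U(∂p))‖ ≤ ‖Z‖` for pv27's plaquette unit `plaqU (torusT P j) (dirForm (cfgGL N U₀)) μ ν x` of an `SU(N)` configuration.
[cite: Balaban1985Variational, (31) p.282; Balaban1985BackgroundPropagators, (3.5) p.391] -/
theorem norm_trN_mul_plaqU_cfgGL_le (U₀ : GaugeField P j (SU N)) (μ ν : Fin P.d) (x : Site P j) (Z : Matrix (Fin N) (Fin N) ℂ) :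
    ‖((N : ℂ)⁻¹ • Matrix.traceLinearMap (Fin N) ℂ ℂ) (Z * ((plaqU (torusT P j) (dirForm (cfgGL N U₀)) μ ν x : (Matrix (Fin N) (Fin N) ℂ)ˣ) : Matrix (Fin N) (Fin N) ℂ))‖ ≤ ‖Z‖ :=
  norm_trN_mul_unitary_le Z (plaqU_cfgGL_mem_unitary U₀ μ ν x)

omit [NeZero N] in
/-- `‖τ_N‖ ≤ 1` as a continuous `ℂ`-linear functional (finite dimension supplies the continuity; `ContinuousLinearMap.opNorm_le_bound`). [cite: Balaban1985Averaging, (20) p.20] -/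
theorem opNorm_trN_le_one : ‖LinearMap.toContinuousLinearMap ((N : ℂ)⁻¹ • Matrix.traceLinearMap (Fin N) ℂ ℂ)‖ ≤ 1 :=
  ContinuousLinearMap.opNorm_le_bound _ zero_le_one fun X => by
    rw [one_mul, LinearMap.coe_toContinuousLinearMap']
    exact norm_trN_le X

/-! ## §2  (31) at every `SU(N)` background of record -/

/-- ★★ **[15] (31) AT THE OBJECTS OF RECORD**: for every `SU(N)` configuration `U₀`, plaquette `p_{μν}(x)`, `η > 0`, letters `A′(b₁), …, A′(b₄) ∈ M_N(ℂ)` («A belonging to the complexified Lie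
algebra») with `‖A′(bᵢ)‖ ≤ aᵢ`: `|η⁻⁴ τ_N(R₄ · U₀(∂p))| ≤ (1∕4!)(Σaᵢ)⁴ e^{η Σaᵢ}`, `R₄ = e^{iηA′(b₁)}⋯e^{iηA′(b₄)} − Σ_{N<4} grade4 N` the terms of order `≥ 4` — r08's `ineq31` with the trace hypothesis
DISCHARGED by `norm_trN_mul_plaqU_cfgGL_le`. [cite: Balaban1985Variational, (29)-(31) p.282; Balaban1985BackgroundPropagators, (3.5) p.391] -/
theorem ineq31_cfgGL (U₀ : GaugeField P j (SU N)) (μ ν : Fin P.d) (x : Site P j) {A₁ A₂ A₃ A₄ : Matrix (Fin N) (Fin N) ℂ} {η a₁ a₂ a₃ a₄ : ℝ}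
    (hη : 0 < η) (h₁ : ‖A₁‖ ≤ a₁) (h₂ : ‖A₂‖ ≤ a₂) (h₃ : ‖A₃‖ ≤ a₃) (h₄ : ‖A₄‖ ≤ a₄) :
    ‖((η ^ 4)⁻¹ : ℝ) • ((N : ℂ)⁻¹ • Matrix.traceLinearMap (Fin N) ℂ ℂ)
        ((exp ((Complex.I * η : ℂ) • A₁) * exp ((Complex.I * η : ℂ) • A₂) * exp ((Complex.I * η : ℂ) • A₃) * exp ((Complex.I * η : ℂ) • A₄)
          - ∑ n ∈ range 4, grade4 ((Complex.I * η : ℂ) • A₁) ((Complex.I * η : ℂ) • A₂) ((Complex.I * η : ℂ) • A₃) ((Complex.I * η : ℂ) • A₄) n) *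
          ((plaqU (torusT P j) (dirForm (cfgGL N U₀)) μ ν x : (Matrix (Fin N) (Fin N) ℂ)ˣ) : Matrix (Fin N) (Fin N) ℂ))‖
      ≤ 1 / 4 ! * (a₁ + a₂ + a₃ + a₄) ^ 4 * Real.exp (η * (a₁ + a₂ + a₃ + a₄)) :=
  ineq31 _ _ (norm_trN_mul_plaqU_cfgGL_le U₀ μ ν x) hη h₁ h₂ h₃ h₄

/-- (31) at the objects of record with any majorant `S ≥ Σaᵢ` of `|A|(∂p)`. [cite: Balaban1985Variational, (31) p.282] -/
theorem ineq31_cfgGL_mono (U₀ : GaugeField P j (SU N)) (μ ν : Fin P.d) (x : Site P j) {A₁ A₂ A₃ A₄ : Matrix (Fin N) (Fin N) ℂ} {η a₁ a₂ a₃ a₄ S : ℝ}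
    (hη : 0 < η) (h₁ : ‖A₁‖ ≤ a₁) (h₂ : ‖A₂‖ ≤ a₂) (h₃ : ‖A₃‖ ≤ a₃) (h₄ : ‖A₄‖ ≤ a₄) (hS : a₁ + a₂ + a₃ + a₄ ≤ S) :
    ‖((η ^ 4)⁻¹ : ℝ) • ((N : ℂ)⁻¹ • Matrix.traceLinearMap (Fin N) ℂ ℂ)
        ((exp ((Complex.I * η : ℂ) • A₁) * exp ((Complex.I * η : ℂ) • A₂) * exp ((Complex.I * η : ℂ) • A₃) * exp ((Complex.I * η : ℂ) • A₄)
          - ∑ n ∈ range 4, grade4 ((Complex.I * η : ℂ) • A₁) ((Complex.I * η : ℂ) • A₂) ((Complex.I * η : ℂ) • A₃) ((Complex.I * η : ℂ) • A₄) n) *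
          ((plaqU (torusT P j) (dirForm (cfgGL N U₀)) μ ν x : (Matrix (Fin N) (Fin N) ℂ)ˣ) : Matrix (Fin N) (Fin N) ℂ))‖
      ≤ 1 / 4 ! * S ^ 4 * Real.exp (η * S) :=
  ineq31_mono _ _ (norm_trN_mul_plaqU_cfgGL_le U₀ μ ν x) hη h₁ h₂ h₃ h₄ hS

/-- (31) against ANY `SU(N)`-valued plaquette variable `g` (e.g. the tree's `GaugeField.plaqHol U₀ p`), same letters. [cite: Balaban1985Variational, (31) p.282] -/
theorem ineq31_coe_SU (g : SU N) {A₁ A₂ A₃ A₄ : Matrix (Fin N) (Fin N) ℂ} {η a₁ a₂ a₃ a₄ : ℝ}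
    (hη : 0 < η) (h₁ : ‖A₁‖ ≤ a₁) (h₂ : ‖A₂‖ ≤ a₂) (h₃ : ‖A₃‖ ≤ a₃) (h₄ : ‖A₄‖ ≤ a₄) :
    ‖((η ^ 4)⁻¹ : ℝ) • ((N : ℂ)⁻¹ • Matrix.traceLinearMap (Fin N) ℂ ℂ)
        ((exp ((Complex.I * η : ℂ) • A₁) * exp ((Complex.I * η : ℂ) • A₂) * exp ((Complex.I * η : ℂ) • A₃) * exp ((Complex.I * η : ℂ) • A₄)
          - ∑ n ∈ range 4, grade4 ((Complex.I * η : ℂ) • A₁) ((Complex.I * η : ℂ) • A₂) ((Complex.I * η : ℂ) • A₃) ((Complex.I * η : ℂ) • A₄) n) *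
          (g : Matrix (Fin N) (Fin N) ℂ))‖
      ≤ 1 / 4 ! * (a₁ + a₂ + a₃ + a₄) ^ 4 * Real.exp (η * (a₁ + a₂ + a₃ + a₄)) :=
  ineq31 _ _ (norm_trN_mul_coe_SU_le · g) hη h₁ h₂ h₃ h₄

/-! ## §3  The third-order remainder of (26) at `τ = τ_N`: the symbolic `‖τ‖` discharged -/

/-- ★ **g0's `norm_rem3_cfgGL_le` AT THE TRACE FUNCTIONAL OF RECORD**: `‖ρ_p‖ ≤ expTail 3 (|η| · Σ_{b⊂∂p}‖A′(b)‖)` — the factor `‖τ‖` of the generic statement is `≤ 1` at `τ = τ_N` (`opNorm_trN_le_one`) and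
`expTail 3 ≥ 0`. [cite: Balaban1985Variational, (26) p.282, (29)-(31) p.282; Balaban1985BackgroundPropagators, (3.12) p.392] -/
theorem norm_rem3_cfgGL_trN_le (η : ℝ) (U₀ : GaugeField P j (SU N)) (A : Fin P.d → Site P j → Matrix (Fin N) (Fin N) ℂ) (μ ν : Fin P.d) (x : Site P j) :
    ‖rem3 (torusT P j) (dirForm (cfgGL N U₀)) η ((N : ℂ)⁻¹ • Matrix.traceLinearMap (Fin N) ℂ ℂ) A μ ν x‖ ≤
      expTail 3 (|η| * size (lettersA (torusT P j) (dirForm (cfgGL N U₀)) A μ ν x)) := by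
  have h := norm_rem3_cfgGL_le (LinearMap.toContinuousLinearMap ((N : ℂ)⁻¹ • Matrix.traceLinearMap (Fin N) ℂ ℂ)) η U₀ A μ ν x
  rw [LinearMap.coe_toContinuousLinearMap] at h
  have hE : 0 ≤ expTail 3 (|η| * size (lettersA (torusT P j) (dirForm (cfgGL N U₀)) A μ ν x)) :=
    expTail_nonneg 3 (mul_nonneg (abs_nonneg η) (size_nonneg _))
  calc _ ≤ ‖LinearMap.toContinuousLinearMap ((N : ℂ)⁻¹ • Matrix.traceLinearMap (Fin N) ℂ ℂ)‖ *
          expTail 3 (|η| * size (lettersA (torusT P j) (dirForm (cfgGL N U₀)) A μ ν x)) := h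
    _ ≤ 1 * expTail 3 (|η| * size (lettersA (torusT P j) (dirForm (cfgGL N U₀)) A μ ν x)) := mul_le_mul_of_nonneg_right opNorm_trN_le_one hE
    _ = _ := one_mul _

end Summit.QuantumFields.YangMills.BalabanUVNodes.N07SectBV4BoundAtObjects

end
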